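import Literature.AlgebraicGeometry.Frobenioids.Prop53Sub
import Literature.AlgebraicGeometry.Frobenioids.RigiditySlimness
import Literature.AlgebraicGeometry.Frobenioids.DivSlimRealification
import Literature.AlgebraicGeometry.Frobenioids.RlfStructure
import HarnessLib

/-!
# Frobenioids I, Cor. 5.4 — "each of the composite functors of this diagram is rigid": the row
# `FrdI.Cor54Sub.Rigid` CLOSED in `_of` form (cell abc-iut, L1 sub-DAG W3, row C54/L08)

Mochizuki, *The geometry of Frobenioids I: the general theory*, Kyushu J. Math. **62** (2008) 293–400,
Cor. 5.4, kurims p. 104 ll. 17–18: "Moreover, each of the composite functors of this diagram is rigid",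
proof ll. 22–24: "by a similar argument applied to prove the rigidity assertion in Corollary 4.11, (i),
(iv)" — i.e. from the Div-slimness of the base (Def. 4.5 (iv) p. 86) [cite: MochizukiFrdI2008, Cor. 5.4 p.104].

PROOF-ONLY (no new notion, no new `Prop` fact).  The typed row `FrdI.Cor54Sub.Rigid hΦ₁ hΦ₂ Ψistr e₁ e₂ Ψrlf`
(`Prop53Sub.lean`, seat abc-iut-w5-d137) reads: Div-slimness of THE realified operations of `C₁`, `C₂` and the
square `ι₁ ⋙ Ψ^rlf ≅ Ψ^istr ⋙ ι₂` imply that both composites are rigid, where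
`ι_i = FrdI.Prop53Sub.iotaRlf F_i hΦ_i e_i = (C_i^istr → C_i^un-tr) ⋙ e_i ⋙ (C_i^un-tr → C_i^rlf)` are THE vertical
arrows of Prop. 5.3.  For ARBITRARY functor binders this is refutable (seat abc-iut-L1-t10,
`Cor54SubRigidAsTyped.lean`: the constant pair); print's case is `Ψ` an EQUIVALENCE ("the horizontal arrows are
equivalences of categories").  This file proves the row for `Ψ^istr` an equivalence, with NO further hypothesis
(L1-lead R100 (3): the weakest binders; neither `IsFrobenioid F₂` nor a compatibility of `e₂` with the functors
to `F_{Φ₂}` is needed):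

* `IsRigidFunctor.whiskeringLeft_comp` — precomposition with a functor along which whiskering is fully
  faithful (a quotient functor such as `C^istr → C^un-tr`, an equivalence) preserves rigidity;
* `RealificationData.isRigidFunctor_toRlfModel` — THE CORE: for a monoid `Φ` with perf-factorial values on `D`
  and any subfunctor of groups `Ψ ⊆ Φ^gp`, the natural functor of model Frobenioids
  `(model of (Φ, Ψ)) → (model of (Φ^rlf, ℝ · Ψ))` (`RealificationData.toRlfModel`, the model description of
  `C^un-tr → C^rlf`, Prop. 5.3) is RIGID as soon as `D` is Div-slim relative to `Φ^rlf`.  Print's "similar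
  argument": a natural automorphism `τ` has isomorphisms as components, so `deg_Fr = 1`, `Div = 0` (`Φ^rlf` is
  divisorial, hence sharp); functoriality along the arrows `(1, id, z, 0)` shows that `Base(τ_X)` fixes the
  image of `Φ` in `Φ^rlf`, hence (injectivity of `Φ → Φ^rlf`, universal property of the realification) acts
  trivially on `Φ^rlf`; the base components along the zero section `A ↦ (A, 0)` restricted to `D_A` form an
  automorphism of `D_A → D` acting trivially on `Φ^rlf`, trivial by Div-slimness; functoriality along
  `(1, id, z, 0)` again transports `Base(τ_X) = id` from `(A, 0)` to every `(A, α)`; finally relation (d) of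
  Thm. 5.2 (i) forces `u_{τ_X} = 0` (`Div_B` is the inclusion `ℝ · Ψ ⊆ (Φ^rlf)^gp`), so `τ = 1`;
* `PreFrobenioid.isRigidFunctor_untrToRlf`, `FrdI.Prop53Sub.isRigidFunctor_iotaRlf` — at THE data
  (`Ψ = Φ^birat`): `C^un-tr → C^rlf` and `ι : C^istr → C^rlf` are rigid over a base Div-slim w.r.t. `Φ^rlf`;
* `FrdI.Cor54Sub.rigid_of` — **row C54/L08 CLOSED** for `[Ψistr.IsEquivalence]`: the second composite by the
  above, the first by transport along the square.

Div-slimness w.r.t. `Φ^rlf` (the row's own antecedent `(rlfData F₂ hΦ₂).IsDivSlim`) is implied by Div-slimness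
w.r.t. `Φ` (seat abc-iut-L1-d2, `isDivSlim_ofFunctor_rlf`, [FrdI] Thm. 6.4 (i) p. 115).  The antecedent for `C₁`
is idle.  No statement of the paper is strengthened; nothing here bears on [IUTchIII] Cor. 3.12.
-/

noncomputable section

namespace Literature.AlgebraicGeometry.Frobenioids

open CategoryTheory Opposite Literature.AnabelianGeometry.EtaleTheta

universe w v v' u u' v₁ v₁' u₁ u₁' v₂ v₂' u₂ u₂' v₃ u₃

/-! ### Rigid functors: precomposition along a functor whose whiskering is fully faithful -/

section Rigid

variable {P : Type u₁} [Category.{v₁} P] {Q : Type u₂} [Category.{v₂} Q] {Z : Type u₃} [Category.{v₃} Z]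

/-- Precomposing a rigid functor `G : Q → Z` with a functor `T : P → Q` along which whiskering
`(Q ⥤ Z) → (P ⥤ Z)` is fully faithful — e.g. a QUOTIENT functor (Mathlib: `Quotient.full_whiskeringLeft_functor`),
such as `C^istr → C^un-tr`, or an equivalence — yields a rigid functor: an automorphism of `T ⋙ G` comes from one
of `G` (FrdI §0 p. 14 "rigid"; cf. `IsRigidFunctor.comp_of_isEquivalence`). [cite: MochizukiFrdI2008, §0 p.14] -/
theorem IsRigidFunctor.whiskeringLeft_comp (T : P ⥤ Q) [((Functor.whiskeringLeft P Q Z).obj T).Full]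
    [((Functor.whiskeringLeft P Q Z).obj T).Faithful] {G : Q ⥤ Z} (hG : IsRigidFunctor G) :
    IsRigidFunctor (T ⋙ G) := by
  intro α
  let hW : ((Functor.whiskeringLeft P Q Z).obj T).FullyFaithful :=
    Functor.FullyFaithful.ofFullyFaithful _
  let β : G ≅ G := hW.preimageIso α
  have hβ : β = Iso.refl G := hG β
  have h : α = ((Functor.whiskeringLeft P Q Z).obj T).mapIso β := (hW.isoEquiv.apply_symm_apply α).symm
  rw [h, hβ]
  ext p
  rfl

end Rigid

/-! ### The core: `(model of (Φ, Ψ)) → (model of (Φ^rlf, ℝ · Ψ))` is rigid over a base Div-slim w.r.t. `Φ^rlf` -/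

namespace RealificationData

variable {D : Type u} [Category.{v} D] {Φ : Dᵒᵖ ⥤ CommMonCat.{w}}

/-- **Rigidity of `C^un-tr → C^rlf` in the model description** (FrdI Cor. 5.4 "each of the composite functors …
is rigid", proof "by a similar argument applied to prove the rigidity assertion in Corollary 4.11, (i), (iv)"):
for `Φ` with perf-factorial values and a subfunctor of groups `Ψ ⊆ Φ^gp`, the functor of model Frobenioids
`(model of (Φ, Ψ)) → (model of (Φ^rlf, ℝ · Ψ))` at THE realification data is rigid whenever `D` is Div-slim
relative to `Φ^rlf` (Def. 4.5 (iv)).  See the module docstring for the argument.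
[cite: MochizukiFrdI2008, Cor. 5.4 p.104] -/
theorem isRigidFunctor_toRlfModel (hΦ : ∀ X : Dᵒᵖ, IsPerfFactorial (Φ.obj X)) (Ψ : GpSubfunctor Φ)
    (hD : (PreFrobenioidData.ofFunctor _
      (ModelFrobenioid.toElem (canonical Φ hΦ).rlf ((canonical Φ hΦ).realSpan Ψ).toMonoid
        ((canonical Φ hΦ).realSpan Ψ).incl)).IsDivSlim) :
    IsRigidFunctor ((canonical Φ hΦ).toRlfModel Ψ) := by
  intro τ
  -- (1) the components are isomorphisms of the model Frobenioid of `(Φ^rlf, ℝ · Ψ)`: `deg_Fr = 1`, `Div = 0`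
  have hdeg : ∀ X : Ψ.ModelOf, ModelFrobenioid.degFr (τ.hom.app X) = 1 := fun X =>
    ModelFrobenioid.degFr_eq_one_of_isIso (τ.hom.app X)
  have hdivo : Objectwise (fun M _ => IsDivisorial M) (canonical Φ hΦ).rlf := fun A =>
    IsPerfFactorial.Rlf.isDivisorial (hΦ (op A))
  have hdiv : ∀ X : Ψ.ModelOf, ModelFrobenioid.div (τ.hom.app X) = 1 := fun X =>
    ModelFrobenioid.div_eq_one_of_isIso hdivo (τ.hom.app X)
  -- the base components `b X := Base(τ_X) : X_D → X_D` (with their types normalised)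
  obtain ⟨b, hb⟩ : ∃ b : ∀ X : Ψ.ModelOf, X.base ⟶ X.base,
      ∀ X : Ψ.ModelOf, ModelFrobenioid.baseMap (τ.hom.app X) = b X :=
    ⟨fun X => (ModelFrobenioid.baseMap (τ.hom.app X) :), fun _ => rfl⟩
  -- the arrows `(1, id, z, 0) : (A, α) → (A, α + z)` of the model of `(Φ, Ψ)`
  let dh : ∀ (X : Ψ.ModelOf) (z : Φ.obj (op X.base)),
      X ⟶ (⟨X.base, X.cls * Algebra.GrothendieckGroup.of z⟩ : Ψ.ModelOf) := fun X z =>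
    ModelFrobenioid.mkHom X _ 1 (𝟙 X.base) z 1 (by
      rw [PNat.one_coe, pow_one, pullGp_id, map_one, mul_one])
  -- naturality of `τ`, read on `Base` (the functor is the identity on base arrows)
  have hnatb : ∀ {X Y : Ψ.ModelOf} (φ : X ⟶ Y),
      ModelFrobenioid.baseMap φ ≫ b Y = b X ≫ ModelFrobenioid.baseMap φ := by
    intro X Y φ
    have h := congrArg ModelFrobenioid.baseMap (τ.hom.naturality φ)
    rw [ModelFrobenioid.baseMap_comp, ModelFrobenioid.baseMap_comp, hb, hb] at h
    exact h
  -- (2) `Base(τ_X)` fixes the image of `Φ(X_D)` in `Φ^rlf(X_D)` (naturality along `(1, id, z, 0)`, read on `Div`) …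
  have hfixι : ∀ (X : Ψ.ModelOf) (z : Φ.obj (op X.base)),
      Frobenioids.pull (rlfFunctor Φ hΦ) (b X) (((toRlfNatTrans Φ hΦ).app (op X.base)).hom z) =
        ((toRlfNatTrans Φ hΦ).app (op X.base)).hom z := by
    intro X z
    have hdz : ModelFrobenioid.div (((canonical Φ hΦ).toRlfModel Ψ).map (dh X z)) =
        ((toRlfNatTrans Φ hΦ).app (op X.base)).hom z := by
      show ((canonical Φ hΦ).toRlf.app (op X.base)).hom z = _
      rw [canonical_toRlf]
      rfl
    have h := congrArg ModelFrobenioid.div (τ.hom.naturality (dh X z))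
    rw [ModelFrobenioid.div_comp, ModelFrobenioid.div_comp, hdz, hdiv, hdiv, hdeg, map_one, one_mul,
      PNat.one_coe, pow_one, one_pow, mul_one, hb] at h
    exact h.symm
  -- … hence acts trivially on `Φ(X_D)` (injectivity of `Φ → Φ^rlf`) …
  have hfixΦ : ∀ (X : Ψ.ModelOf) (z : Φ.obj (op X.base)), Frobenioids.pull Φ (b X) z = z := by
    intro X z
    have hn := congrArg (fun g => (CommMonCat.Hom.hom g) z) ((toRlfNatTrans Φ hΦ).naturality (b X).op)
    simp only [CommMonCat.hom_comp, MonoidHom.coe_comp, Function.comp_apply] at hn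
    exact toRlfNatTrans_app_injective Φ hΦ (op X.base) (hn.trans (hfixι X z))
  -- … hence acts trivially on all of `Φ^rlf(X_D)` (`Φ^rlf(b) = Φ(b)^rlf`, universal property)
  have hfixR : ∀ (X : Ψ.ModelOf) (y : (rlfFunctor Φ hΦ).obj (op X.base)),
      Frobenioids.pull (rlfFunctor Φ hΦ) (b X) y = y := by
    intro X y
    have hid : (Φ.map (b X).op).hom = MonoidHom.id _ := MonoidHom.ext (hfixΦ X)
    show ((rlfFunctor Φ hΦ).map (b X).op).hom y = y
    rw [rlfFunctor_map_hom, IsPerfFactorial.Rlf.rlfMap_eq_map, hid, IsPerfFactorial.Rlf.map_id']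
    rfl
  -- (3) along the zero section over `D_A` the base components form an automorphism of `D_A → D` acting
  -- trivially on `Φ^rlf`: trivial by Div-slimness
  have hzero : ∀ A : D, b (ModelFrobenioid.zeroObj Φ Ψ.toMonoid Ψ.incl A) = 𝟙 A := by
    intro A
    let Zs : Over A → Ψ.ModelOf := fun U => ModelFrobenioid.zeroObj Φ Ψ.toMonoid Ψ.incl U.left
    let β : Aut (Over.forget A) := NatIso.ofComponents
      (fun U => (ModelFrobenioid.baseFunctor _ _ _).mapIso (τ.app (Zs U)))
      (by
        intro U U' m
        have h := congrArg ModelFrobenioid.baseMap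
          (τ.hom.naturality (ModelFrobenioid.zeroHom (Φ := Φ) (B := Ψ.toMonoid) (DivB := Ψ.incl) 1 m.left))
        exact h)
    have hβ : β = 1 := by
      refine hD.eq_one A β fun U y => ?_
      show Frobenioids.pull (rlfFunctor Φ hΦ) (ModelFrobenioid.baseMap (τ.hom.app (Zs U))) y = y
      rw [hb]
      exact hfixR (Zs U) y
    have h := congrArg (fun i : Aut (Over.forget A) => i.hom.app (Over.mk (𝟙 A))) hβ
    exact (hb _).symm.trans h
  -- (4) `Base(τ_X) = id` for every `X = (A, α)`: transport along `(1, id, z, 0)` from `(A, 0)`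
  have hcls : ∀ (X : Ψ.ModelOf) (z : Φ.obj (op X.base)),
      b X = b ⟨X.base, X.cls * Algebra.GrothendieckGroup.of z⟩ := by
    intro X z
    have h : 𝟙 X.base ≫ b ⟨X.base, X.cls * Algebra.GrothendieckGroup.of z⟩ = b X ≫ 𝟙 X.base :=
      hnatb (dh X z)
    rw [Category.id_comp, Category.comp_id] at h
    exact h.symm
  have hbase : ∀ X : Ψ.ModelOf, b X = 𝟙 X.base := by
    intro X
    obtain ⟨a, c, hac⟩ := gp_exists_mul_of_eq_of X.cls
    have e1 := hcls X c
    have e2 : b ⟨X.base, X.cls * Algebra.GrothendieckGroup.of c⟩ =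
        b ⟨X.base, 1 * Algebra.GrothendieckGroup.of a⟩ := by
      rw [hac, one_mul]
    have e3 := hcls (ModelFrobenioid.zeroObj Φ Ψ.toMonoid Ψ.incl X.base) a
    rw [e1, e2]
    exact e3.symm.trans (hzero X.base)
  -- (5) relation (d) of Thm. 5.2 (i) forces `u_{τ_X} = 0`
  have hunit : ∀ X : Ψ.ModelOf, ModelFrobenioid.unit (τ.hom.app X) = 1 := by
    intro X
    have hp : pullGp (canonical Φ hΦ).rlf (ModelFrobenioid.baseMap (τ.hom.app X))
        (((canonical Φ hΦ).toRlfModel Ψ).obj X).cls = (((canonical Φ hΦ).toRlfModel Ψ).obj X).cls := by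
      rw [hb, hbase]
      exact pullGp_id _ _
    have h := ModelFrobenioid.rel (τ.hom.app X)
    rw [hdeg, hdiv, PNat.one_coe, pow_one, map_one, mul_one, hp] at h
    -- `h : cls = cls * ↑u` in the group `(Φ^rlf)^gp(X_D)`
    exact Subtype.ext (left_eq_mul.mp h)
  -- conclusion
  refine Iso.ext (NatTrans.ext (funext fun X => ?_))
  apply ModelFrobenioid.hom_ext
  · exact hdeg X
  · exact (hb X).trans ((hbase X).trans rfl)
  · exact hdiv X
  · exact hunit X

end RealificationData

/-! ### At THE data of a Frobenioid: `C^un-tr → C^rlf` and `ι : C^istr → C^rlf` are rigid -/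

namespace PreFrobenioid

variable {D : Type u} [Category.{v} D] {Φ : Dᵒᵖ ⥤ CommMonCat.{w}}
  {C : Type u'} [Category.{v'} C] (F : C ⥤ ElemFrobenioid Φ) (hΦ : IsPerfFactorialOn Φ)

/-- **`C^un-tr → C^rlf` (model descriptions, Prop. 5.3) is rigid** over a base Div-slim relative to `Φ^rlf`
(the antecedent `(rlfData F hΦ).IsDivSlim` of the typed row `FrdI.Cor54Sub.Rigid`).
[cite: MochizukiFrdI2008, Cor. 5.4 p.104] -/
theorem isRigidFunctor_untrToRlf (hD : (FrdI.Cor54Sub.rlfData F hΦ).IsDivSlim) :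
    IsRigidFunctor (untrToRlf F hΦ) :=
  RealificationData.isRigidFunctor_toRlfModel (IsPerfFactorialOn.op hΦ) (biratSubfunctor F) hD

end PreFrobenioid

namespace FrdI.Prop53Sub

variable {D : Type u} [Category.{v} D] {Φ : Dᵒᵖ ⥤ CommMonCat.{w}}
  {C : Type u'} [Category.{v'} C] (F : C ⥤ ElemFrobenioid Φ) (hΦ : PreFrobenioid.IsPerfFactorialOn Φ)

/-- **THE vertical arrow `ι : C^istr → C^un-tr ≌ (model) → C^rlf` of Prop. 5.3 is rigid** over a base
Div-slim relative to `Φ^rlf`, for ANY comparison equivalence `e` (`C^istr → C^un-tr` is full and surjective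
on objects — a quotient functor —, `e` is an equivalence, `C^un-tr → C^rlf` is rigid).
[cite: MochizukiFrdI2008, Cor. 5.4 p.104] -/
theorem isRigidFunctor_iotaRlf (e : (PreFrobenioidData.ofFunctor Φ F).Untr ≌ PreFrobenioid.untrModel F)
    (hD : (FrdI.Cor54Sub.rlfData F hΦ).IsDivSlim) : IsRigidFunctor (iotaRlf F hΦ e) := by
  unfold iotaRlf
  exact IsRigidFunctor.whiskeringLeft_comp (PreFrobenioidData.ofFunctor Φ F).toUntr
    (IsRigidFunctor.comp_of_isEquivalence e.functor (PreFrobenioid.isRigidFunctor_untrToRlf F hΦ hD))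

end FrdI.Prop53Sub

/-! ### Row C54/L08 CLOSED: `FrdI.Cor54Sub.Rigid` for `Ψ^istr` an equivalence -/

namespace FrdI.Cor54Sub

variable {D₁ : Type u₁'} [Category.{v₁'} D₁] {Φ₁ : D₁ᵒᵖ ⥤ CommMonCat.{w}}
  {C₁ : Type u₁} [Category.{v₁} C₁] {F₁ : C₁ ⥤ ElemFrobenioid Φ₁} (hΦ₁ : PreFrobenioid.IsPerfFactorialOn Φ₁)
  {D₂ : Type u₂'} [Category.{v₂'} D₂] {Φ₂ : D₂ᵒᵖ ⥤ CommMonCat.{w}}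
  {C₂ : Type u₂} [Category.{v₂} C₂] {F₂ : C₂ ⥤ ElemFrobenioid Φ₂} (hΦ₂ : PreFrobenioid.IsPerfFactorialOn Φ₂)
  (Ψistr : (PreFrobenioidData.ofFunctor Φ₁ F₁).Istr ⥤ (PreFrobenioidData.ofFunctor Φ₂ F₂).Istr)
  (e₁ : (PreFrobenioidData.ofFunctor Φ₁ F₁).Untr ≌ PreFrobenioid.untrModel F₁)
  (e₂ : (PreFrobenioidData.ofFunctor Φ₂ F₂).Untr ≌ PreFrobenioid.untrModel F₂)
  (Ψrlf : PreFrobenioid.rlf F₁ hΦ₁ ⥤ PreFrobenioid.rlf F₂ hΦ₂)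

/-- **Cor. 5.4, "Moreover, each of the composite functors of this diagram is rigid" — row C54/L08
`FrdI.Cor54Sub.Rigid` CLOSED** in print's case `Ψ^istr` an EQUIVALENCE ("the horizontal arrows are
equivalences of categories"), for ALL comparison equivalences `e₁`, `e₂` and every `Ψ^rlf` fitting the square:
`Ψ^istr ⋙ ι₂` is rigid since `ι₂` is (`FrdI.Prop53Sub.isRigidFunctor_iotaRlf`, from the Div-slimness of
`D₂` w.r.t. `Φ₂^rlf`), and `ι₁ ⋙ Ψ^rlf ≅ Ψ^istr ⋙ ι₂` is rigid by transport along the square.  (For arbitrary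
functors `Ψ^istr` the row is refutable: `Cor54SubRigidAsTyped.lean`.) [cite: MochizukiFrdI2008, Cor. 5.4 p.104] -/
theorem rigid_of [Ψistr.IsEquivalence] : Rigid hΦ₁ hΦ₂ Ψistr e₁ e₂ Ψrlf := by
  intro _ h₂ hsq
  have h2 : IsRigidFunctor (Ψistr ⋙ FrdI.Prop53Sub.iotaRlf F₂ hΦ₂ e₂) :=
    IsRigidFunctor.comp_of_isEquivalence Ψistr (FrdI.Prop53Sub.isRigidFunctor_iotaRlf F₂ hΦ₂ e₂ h₂)
  refine ⟨?_, h2⟩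
  -- transport along the square `s : ι₁ ⋙ Ψ^rlf ≅ Ψ^istr ⋙ ι₂`
  obtain ⟨s⟩ := hsq
  intro α
  have h := h2 (s.symm ≪≫ α ≪≫ s)
  have h' : α = s ≪≫ (s.symm ≪≫ α ≪≫ s) ≪≫ s.symm :=
    Iso.ext (NatTrans.ext (funext fun X => by simp))
  rw [h', h]
  exact Iso.ext (NatTrans.ext (funext fun X => by simp))

end FrdI.Cor54Sub

end Literature.AlgebraicGeometry.Frobenioids

end
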